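import Mathlib.MeasureTheory.Function.Jacobian
import Mathlib.Analysis.Calculus.FDeriv.Prod
import Mathlib.Analysis.Calculus.FDeriv.Add
import Mathlib.MeasureTheory.Constructions.Pi
import Mathlib.MeasureTheory.Measure.Lebesgue.Basic
import HarnessLib

/-!
# Null sets in the slab decomposition: cylinders over null base sets and wall graphs

Two measure-zero facts used when a bounded set of `ℝᵈ⁺¹` is exhausted, up to a null set, by open
slabs over base charts (Jung's projection method; last coordinate distinguished via `Fin.init`,
`Fin.snoc`, `Fin.last`):

* `volume_setOf_init_mem_eq_zero` — the cylinder `{u | init u ∈ N}` over a Lebesgue-null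
  `N ⊆ ℝᵈ` (not necessarily measurable) is Lebesgue-null in `ℝᵈ⁺¹` (Fubini through
  `MeasureTheory.volume_preserving_piFinSuccAbove`);
* `volume_wallGraph_eq_zero` — the graph `{(φ σ, w σ) | σ ∈ Ω}` of a wall over the image of a base
  map, both differentiable at the points of `Ω`, is Lebesgue-null: it is the image of the null
  hyperplane piece `Ω × {0}` under the differentiable map `(σ, s) ↦ (φ σ, w σ + s)`
  (`MeasureTheory.addHaar_image_eq_zero_of_differentiableOn_of_addHaar_eq_zero`).

## References

* H. Federer, *Geometric Measure Theory* (1969), 2.10.11, 3.2.3 (images of null sets under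
  Lipschitz / differentiable maps).
-/

noncomputable section

open Set MeasureTheory

namespace Literature.NumberTheory.Transcendental

variable {d : ℕ}

/-- **Cylinders over null sets are null.** If `N ⊆ ℝᵈ` has Lebesgue (outer) measure zero then so
has `{u ∈ ℝᵈ⁺¹ | init u ∈ N}`. [folklore] -/
theorem volume_setOf_init_mem_eq_zero {N : Set (Fin d → ℝ)} (hN : volume N = 0) :
    volume {u : Fin (d + 1) → ℝ | Fin.init u ∈ N} = 0 := by
  obtain ⟨N', hNN', hN'm, hN'0⟩ := exists_measurable_superset_of_null hN
  refine measure_mono_null (t := {u : Fin (d + 1) → ℝ | Fin.init u ∈ N'}) (fun u hu => hNN' hu) ?_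
  set e := MeasurableEquiv.piFinSuccAbove (fun _ : Fin (d + 1) => ℝ) (Fin.last d) with he
  have hset : {u : Fin (d + 1) → ℝ | Fin.init u ∈ N'} = e ⁻¹' (univ ×ˢ N') := by
    ext u
    simp only [mem_setOf_eq, mem_preimage, mem_prod, mem_univ, true_and, he,
      MeasurableEquiv.piFinSuccAbove_apply, Fin.insertNthEquiv]
    exact Iff.of_eq (congrArg (· ∈ N') (funext fun j => by simp [Fin.init]))
  rw [hset, (volume_preserving_piFinSuccAbove (fun _ : Fin (d + 1) => ℝ) (Fin.last d)).measure_preimage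
    (MeasurableSet.univ.prod hN'm).nullMeasurableSet, Measure.volume_eq_prod, Measure.prod_prod, hN'0,
    mul_zero]

/-- The hyperplane piece `{z | z_d = 0}` of `ℝᵈ⁺¹` is Lebesgue-null. [folklore] -/
theorem volume_setOf_apply_last_eq_zero :
    volume {z : Fin (d + 1) → ℝ | z (Fin.last d) = 0} = 0 := by
  rw [volume_pi]
  exact Measure.pi_hyperplane (fun _ : Fin (d + 1) => (volume : Measure ℝ)) (Fin.last d) (0 : ℝ)

/-- **Wall graphs are null.** For `φ : ℝᵈ → ℝᵈ` and `w : ℝᵈ → ℝ` differentiable at every point of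
`Ω`, the graph `{u | ∃ σ ∈ Ω, init u = φ σ ∧ u_d = w σ} ⊆ ℝᵈ⁺¹` of `w` over `φ(Ω)` has Lebesgue
measure zero. [folklore] -/
theorem volume_wallGraph_eq_zero {Ω : Set (Fin d → ℝ)} {φ : (Fin d → ℝ) → (Fin d → ℝ)}
    {w : (Fin d → ℝ) → ℝ} (hφ : ∀ σ ∈ Ω, DifferentiableAt ℝ φ σ)
    (hw : ∀ σ ∈ Ω, DifferentiableAt ℝ w σ) :
    volume {u : Fin (d + 1) → ℝ | ∃ σ ∈ Ω, Fin.init u = φ σ ∧ u (Fin.last d) = w σ} = 0 := by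
  -- the parametrisation `F (σ, s) = (φ σ, w σ + s)` of a neighbourhood of the graph
  set F : (Fin (d + 1) → ℝ) → (Fin (d + 1) → ℝ) := fun z =>
    Fin.snoc (φ (Fin.init z)) (w (Fin.init z) + z (Fin.last d)) with hF
  set H : Set (Fin (d + 1) → ℝ) := {z | Fin.init z ∈ Ω ∧ z (Fin.last d) = 0} with hH
  have hsub : {u : Fin (d + 1) → ℝ | ∃ σ ∈ Ω, Fin.init u = φ σ ∧ u (Fin.last d) = w σ} ⊆ F '' H := by
    rintro u ⟨σ, hσ, hinit, hlast⟩
    refine ⟨Fin.snoc σ 0, ⟨by simpa using hσ, by simp⟩, ?_⟩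
    rw [hF]
    simp only [Fin.init_snoc, Fin.snoc_last, add_zero]
    rw [← hinit, ← hlast, Fin.snoc_init_self]
  refine measure_mono_null hsub
    (addHaar_image_eq_zero_of_differentiableOn_of_addHaar_eq_zero volume ?_ ?_)
  · intro z hz
    have hz' : Fin.init z ∈ Ω := hz.1
    let initL : (Fin (d + 1) → ℝ) →L[ℝ] (Fin d → ℝ) :=
      ContinuousLinearMap.pi fun j => ContinuousLinearMap.proj (Fin.castSucc j)
    have hinitL : ∀ v, initL v = Fin.init v := fun v => rfl
    have hinit : DifferentiableAt ℝ (fun z : Fin (d + 1) → ℝ => Fin.init z) z :=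
      initL.differentiableAt
    have hφ' : DifferentiableAt ℝ (fun z : Fin (d + 1) → ℝ => φ (Fin.init z)) z :=
      DifferentiableAt.comp z (hinitL z ▸ hφ _ hz' :) hinit
    have hw' : DifferentiableAt ℝ (fun z : Fin (d + 1) → ℝ => w (Fin.init z)) z :=
      DifferentiableAt.comp z (hinitL z ▸ hw _ hz' :) hinit
    refine DifferentiableAt.differentiableWithinAt ?_
    rw [hF]
    refine differentiableAt_pi.2 fun i => ?_
    refine Fin.lastCases ?_ (fun j => ?_) i
    · simp only [Fin.snoc_last]
      exact hw'.add (differentiableAt_apply (Fin.last d) z)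
    · simp only [Fin.snoc_castSucc]
      exact (differentiableAt_apply j _).comp z hφ'
  · exact measure_mono_null (fun z hz => hz.2) volume_setOf_apply_last_eq_zero

end Literature.NumberTheory.Transcendental
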